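import Literature.Claims.NS.ClayR3SupBlowupCertificate
import Literature.Analysis.FluidPDE.BoundedLerayHopfClay
import Literature.Analysis.FluidPDE.ClayClassLerayHopfUniqueness
import Literature.Analysis.FluidPDE.NSLerayExistenceR3Holds
import Literature.Analysis.FluidPDE.KatoMaximalTimeSingular
import HarnessLib

/-!
# Clay (A) reference — (A) ⇔ the datum-wise Serrin `L^∞` criterion for Leray–Hopf weak solutions
# on `ℝ³`: every global Leray–Hopf solution from Clay data is (locally, essentially) bounded

`ℝ³` twin of `ClayPeriodicLerayHopfBridge.lean` ((B) ⇔ every global torus Leray–Hopf solution from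
smooth data is essentially bounded from the left). Claimed proofs adjudicated by the cell `ns-claims`
(D-0090) that work with WEAK solutions on `ℝ³` («the Leray–Hopf solution from `u₀` is bounded /
regular / satisfies Serrin's condition, hence smooth and global») are measured against Fefferman's (A)
through this file. Everything is assembled from tree theorems: Leray's existence theorem
(`leray_existence_R3_holds`), the datum-wise Serrin `L^∞_tL^∞_x` bridge
`clay_solution_of_locallyBounded_globalLerayHopf` (Kato's maximal-time dichotomy + Lemarié-Rieusset's
singular point, `BoundedLerayHopfClay.lean`), Clay-class weak–strong uniqueness
`IsNavierStokesSolution.ae_eq_of_isLerayHopfOn` (Tao 2013 Lemma 8.1 + Cor. 11.1 + Prodi–Serrin), and the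
bounds of the Clay solution on closed slabs (`exists_norm_iteratedFDeriv_le_of_claySolution`).

* `exists_isGlobalLerayHopf_of_clayDatum` — every Clay datum (smooth, divergence free, class (4)) has a
  global Leray–Hopf weak solution at every `μ > 0` (Leray 1934);
* `lerayHopf_aeBounded_of_clayR3_solvable` / `lerayHopf_locallyBounded_of_clayR3_solvable` —
  (A)-solvability of ONE Cauchy problem forces EVERY global Leray–Hopf solution from that datum to agree
  with the Clay solution, hence to be essentially bounded on every strip `(0, T] × ℝ³` and on a
  parabolic cylinder below every point;
* `clayR3_regularityAt_iff_lerayHopf_locallyBounded` / `clayR3_regularity_iff_lerayHopf_locallyBounded(_at)`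
  — **(A) ⇔ every global Leray–Hopf solution from a Clay datum is essentially bounded on some
  parabolic cylinder `Q_r(T, x)` below every point `(T, x)`, `T > 0`** (the exact hypothesis shape of
  `clay_solution_of_locallyBounded_globalLerayHopf`);
* `clayR3_regularityAt_iff_lerayHopf_aeBounded` / `clayR3_regularity_iff_lerayHopf_aeBounded(_at)` —
  **(A) ⇔ every global Leray–Hopf solution from a Clay datum is essentially bounded on every strip**:
  `∀ T > 0, ∃ M, ∀ t ∈ (0, T], ‖v(t, ·)‖ ≤ M` a.e.;
* `lerayHopf_locallyBounded_of_ae_classical`, `clayR3_regularityAt_iff_lerayHopf_aeClassical` /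
  `clayR3_regularity_iff_lerayHopf_aeClassical(_at)` (appended 2026-08-27) — **(A) ⇔ every global
  Leray–Hopf solution from a Clay datum agrees for every `t > 0` a.e. with a classical solution on
  `(0, ∞)`** («all Leray solutions become smooth»; first consumer `Faliush2026.clayA_of_claimedR3`).

Usage on a CARD (§3): a REG claim printed over Leray–Hopf weak solutions on `ℝ³` — «the weak solution
from smooth data is bounded (locally / on every strip), hence regular and global» — IS (A) for class-(4)
data by these equivalences (the Serrin/ESS regularity step, uniqueness and the smooth representative are
supplied by the tree); what stays a delta is a data class wider than (4) (Δ4, STRONGER direction), a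
force (Δ3), or a bound in a weaker norm than `L^∞` (then use `ClayR3L3Bridge` for `L³`, or record Δ5).

## References
* C. L. Fefferman, CMI 2006, (A) with (4)–(7) p. 2. [FeffermanClay2006]
* J. Leray, Acta Math. 63 (1934), §III Thm. of §34; §33. [Leray1934]
* J. Serrin, Arch. Rational Mech. Anal. 9 (1962) 187–195 (the `L^∞` case). [Serrin1962]
* P. G. Lemarié-Rieusset, *The Navier–Stokes Problem in the 21st Century*, CRC 2016, Prop. 12.3,
  Thm. 15.1 (C). [LemarieRieusset2016]
* T. Tao, Anal. PDE 6 (2013) = arXiv:1108.1165, Lemma 8.1, Cor. 11.1. [Tao2011]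
* J. C. Robinson, J. L. Rodrigo, W. Sadowski, CUP 2016, Thm. 8.19. [RobinsonRodrigoSadowski2016]

WHAT THIS IS NOT: not a claim about NS regularity or blow-up; not a claim about any author beyond
the typed locator.
-/

open scoped ContDiff ENNReal NNReal Topology

namespace Literature.Claims.NS.ClayVariants

open Set Filter MeasureTheory Function Literature.Analysis Literature.Analysis.FluidPDE

noncomputable section

variable {μ : ℝ} {u₀ : EuclideanSpace ℝ (Fin 3) → EuclideanSpace ℝ (Fin 3)}
  {v : ℝ → EuclideanSpace ℝ (Fin 3) → EuclideanSpace ℝ (Fin 3)}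

/-! ## Clay data carry global Leray–Hopf solutions -/

/-- A Clay datum is square integrable (class (4) with `n = 0`: `(1+|x|)^K |u₀| ≤ C`).
[cite: FeffermanClay2006, (4) p. 1] -/
private theorem memLp_two_of_clayDatum (hu₀ : ContDiff ℝ ∞ u₀) (hdec : HasRapidSpatialDecay u₀) :
    MemLp u₀ 2 volume := by
  have hL2 : ∫⁻ x, ‖u₀ x‖ₑ ^ 2 < ⊤ := by
    refine lt_of_le_of_lt (le_of_eq (lintegral_congr fun x => ?_))
      (hdec.lintegral_enorm_iteratedFDeriv_sq_lt_top (μ := volume) 0)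
    rw [← ofReal_norm, ← ofReal_norm, norm_iteratedFDeriv_zero]
  exact ⟨hu₀.continuous.aestronglyMeasurable, eLpNorm_two_lt_top_of_lintegral_enorm_sq_lt_top hL2⟩

/-- **Every Clay datum has a global Leray–Hopf weak solution** at every viscosity `μ > 0` (Leray 1934,
§34: existence for every divergence-free `u₀ ∈ L²`; tree theorem `leray_existence_R3_holds`).
[cite: Leray1934, §34] -/
theorem exists_isGlobalLerayHopf_of_clayDatum (hμ : 0 < μ) (hu₀ : ContDiff ℝ ∞ u₀)
    (hdiv : NSWave0.IsDivFree u₀) (hdec : HasRapidSpatialDecay u₀) :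
    ∃ v : ℝ → EuclideanSpace ℝ (Fin 3) → EuclideanSpace ℝ (Fin 3), IsGlobalLerayHopf μ 0 u₀ v :=
  leray_existence_R3_holds μ hμ u₀ (memLp_two_of_clayDatum hu₀ hdec)
    (VectorCalculus.IsDivFree.isWeaklyDivFree_holds (fun x => hdiv x) (hu₀.of_le (mod_cast le_top)))

/-! ## (A)-solvability bounds every Leray–Hopf solution from the datum -/

/-- **(A)-solvability of one Cauchy problem bounds every global Leray–Hopf solution from that datum on
every strip**: if `(μ, 0, u₀)` is Clay-solvable (`u₀` of class (4)) and `v` is a global Leray–Hopf weak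
solution from `u₀`, then for every `T > 0` there is `M` with `‖v(t, x)‖ ≤ M` for a.e. `x`, for every
`t ∈ (0, T]`: `v(t) = U(t)` a.e. for the Clay solution `U` (Tao 2013 Lemma 8.1 + Cor. 11.1 +
Prodi–Serrin; `IsNavierStokesSolution.ae_eq_of_isLerayHopfOn`), which is bounded on `[0, T] × ℝ³`
(`exists_norm_iteratedFDeriv_le_of_claySolution`). [cite: FeffermanClay2006, (A) with (4) (6) (7) p. 2]
[cite: Tao2011, Lemma 8.1 and Cor. 11.1] [cite: RobinsonRodrigoSadowski2016, Thm. 8.19] -/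
theorem lerayHopf_aeBounded_of_clayR3_solvable (hμ : 0 < μ) (hdec : HasRapidSpatialDecay u₀)
    (hsol : clayR3.Solvable μ 0 u₀) (hv : IsGlobalLerayHopf μ 0 u₀ v) {T : ℝ} (hT : 0 < T) :
    ∃ M : ℝ, ∀ t ∈ Ioc 0 T, ∀ᵐ x ∂volume, ‖v t x‖ ≤ M := by
  obtain ⟨U, P, hU, hP, hns, hE⟩ := hsol
  have hae : ∀ t ∈ Ioc 0 T, v t =ᵐ[volume] U t :=
    hns.ae_eq_of_isLerayHopfOn hμ hT hdec hU hP hE (hv T hT)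
  have hcl : IsClassicalNSSolutionOn (Ici 0) μ 0 U P :=
    (isNavierStokesSolution_and_smooth_iff.1 ⟨hns, hU, hP⟩).1
  obtain ⟨B, -, hB⟩ := exists_norm_iteratedFDeriv_le_of_claySolution hμ hdec hcl hns.initial hE hT 0
  refine ⟨B, fun t ht => (hae t ht).mono fun x hx => ?_⟩
  rw [hx]
  simpa using hB t ⟨ht.1.le, ht.2⟩ x

/-- **(A)-solvability bounds every global Leray–Hopf solution from the datum on the whole open strip
`(0, T) × ℝ³`, product-a.e.** [cite: FeffermanClay2006, (A) with (4) (6) (7) p. 2]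
[cite: Tao2011, Lemma 8.1 and Cor. 11.1] -/
theorem lerayHopf_ae_strip_bound_of_clayR3_solvable (hμ : 0 < μ) (hdec : HasRapidSpatialDecay u₀)
    (hsol : clayR3.Solvable μ 0 u₀) (hv : IsGlobalLerayHopf μ 0 u₀ v) {T : ℝ} (hT : 0 < T) :
    ∃ M : ℝ, ∀ᵐ z ∂(volume.restrict (Ioo 0 T ×ˢ (univ : Set (EuclideanSpace ℝ (Fin 3))))),
      ‖uncurry v z‖ ≤ M := by
  obtain ⟨U, P, hU, hP, hns, hE⟩ := hsol
  have hae : ∀ t ∈ Ioo 0 T, v t =ᵐ[volume] U t := fun t ht =>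
    hns.ae_eq_of_isLerayHopfOn hμ hT hdec hU hP hE (hv T hT) t ⟨ht.1, ht.2.le⟩
  have hcl : IsClassicalNSSolutionOn (Ici 0) μ 0 U P :=
    (isNavierStokesSolution_and_smooth_iff.1 ⟨hns, hU, hP⟩).1
  obtain ⟨B, -, hB⟩ := exists_norm_iteratedFDeriv_le_of_claySolution hμ hdec hcl hns.initial hE hT 0
  -- measurability of both fields on the strip
  have hmeasS : MeasurableSet (Ioo 0 T ×ˢ (univ : Set (EuclideanSpace ℝ (Fin 3)))) :=
    measurableSet_Ioo.prod MeasurableSet.univ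
  have hUm : AEStronglyMeasurable (uncurry U)
      (volume.restrict (Ioo 0 T ×ˢ (univ : Set (EuclideanSpace ℝ (Fin 3))))) :=
    (hcl.smooth_velocity.continuousOn.mono
      (prod_mono (Ioo_subset_Ioi_self.trans Ioi_subset_Ici_self) Subset.rfl)
      ).aestronglyMeasurable hmeasS
  have hprod : uncurry v =ᵐ[volume.restrict (Ioo 0 T ×ˢ univ)] uncurry U :=
    ae_restrict_prod_of_forall_ae_eq hae (hv T hT).weak.1 hUm
  refine ⟨B, ?_⟩
  filter_upwards [hprod, ae_restrict_mem hmeasS] with z hz hzS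
  obtain ⟨t, x⟩ := z
  rw [hz, uncurry_apply_pair]
  simpa using hB t (Ioo_subset_Icc_self (mem_prod.1 hzS).1) x

/-- A parabolic cylinder `Q_r(T, x)` with `r = min 1 √(T/2)` lies in the strip `(0, T) × ℝ³`.
[cite: LemarieRieusset2016, Prop. 12.3 (notation)] -/
private theorem parabolicCylinder_subset_strip {T : ℝ} (hT : 0 < T) (x : EuclideanSpace ℝ (Fin 3)) :
    0 < min 1 (Real.sqrt (T / 2)) ∧
      parabolicCylinder (min 1 (Real.sqrt (T / 2))) ((T : ℝ), x) ⊆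
        Ioo 0 T ×ˢ (univ : Set (EuclideanSpace ℝ (Fin 3))) := by
  set r : ℝ := min 1 (Real.sqrt (T / 2)) with hr_def
  have hr0 : 0 < r := lt_min one_pos (Real.sqrt_pos.2 (by positivity))
  have hr2 : r ^ 2 ≤ T / 2 := by
    calc r ^ 2 ≤ Real.sqrt (T / 2) ^ 2 := pow_le_pow_left₀ hr0.le (min_le_right _ _) 2
      _ = T / 2 := Real.sq_sqrt (by positivity)
  refine ⟨hr0, fun z hz => ?_⟩
  obtain ⟨s, y⟩ := z
  rw [mem_parabolicCylinder] at hz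
  exact ⟨⟨by linarith [hz.1.1, hr2], hz.1.2⟩, mem_univ _⟩

/-- **(A)-solvability ⇒ every global Leray–Hopf solution from the datum is essentially bounded on a
parabolic cylinder below every point** (the hypothesis shape of
`clay_solution_of_locallyBounded_globalLerayHopf`). [cite: FeffermanClay2006, (A) with (4) (6) (7) p. 2]
[cite: LemarieRieusset2016, Thm. 15.1 (C) and Prop. 12.3] -/
theorem lerayHopf_locallyBounded_of_clayR3_solvable (hμ : 0 < μ) (hdec : HasRapidSpatialDecay u₀)
    (hsol : clayR3.Solvable μ 0 u₀) (hv : IsGlobalLerayHopf μ 0 u₀ v) :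
    ∀ T : ℝ, 0 < T → ∀ x : EuclideanSpace ℝ (Fin 3), ∃ r : ℝ, 0 < r ∧
      eLpNorm (uncurry v) ⊤ (volume.restrict (parabolicCylinder r ((T : ℝ), x))) < ⊤ := by
  intro T hT x
  obtain ⟨hr0, hsub⟩ := parabolicCylinder_subset_strip hT x
  obtain ⟨M, hM⟩ := lerayHopf_ae_strip_bound_of_clayR3_solvable hμ hdec hsol hv hT
  refine ⟨_, hr0, ?_⟩
  rw [eLpNorm_exponent_top]
  exact eLpNormEssSup_lt_top_of_ae_bound (C := M) (ae_restrict_of_ae_restrict_of_subset hsub hM)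

/-! ## (A) ⇔ local essential boundedness of Leray–Hopf solutions -/

/-- **Clay (A) at viscosity `μ` ⇔ every global Leray–Hopf weak solution from a Clay datum is
essentially bounded on some parabolic cylinder below every point `(T, x)`, `T > 0`** (the datum-wise
Serrin `L^∞_tL^∞_x` criterion). (⇒): `lerayHopf_locallyBounded_of_clayR3_solvable`; (⇐): Leray's
existence theorem gives a global Leray–Hopf solution from the datum, locally bounded by hypothesis,
and `clay_solution_of_locallyBounded_globalLerayHopf` (Kato maximal time + singular point) turns it into
a Clay solution. [cite: FeffermanClay2006, (A) with (4) (6) (7) p. 2] [cite: Leray1934, §34]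
[cite: Serrin1962, Thm. (L^∞ case)] [cite: LemarieRieusset2016, Thm. 15.1 (C) and Prop. 12.3]
[cite: Tao2011, Lemma 8.1 and Cor. 11.1] -/
theorem clayR3_regularityAt_iff_lerayHopf_locallyBounded (hμ : 0 < μ) :
    clayR3.RegularityAt μ ↔
      ∀ (u₀ : EuclideanSpace ℝ (Fin 3) → EuclideanSpace ℝ (Fin 3)), ContDiff ℝ ∞ u₀ →
        NSWave0.IsDivFree u₀ → HasRapidSpatialDecay u₀ →
        ∀ v : ℝ → EuclideanSpace ℝ (Fin 3) → EuclideanSpace ℝ (Fin 3), IsGlobalLerayHopf μ 0 u₀ v →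
          ∀ T : ℝ, 0 < T → ∀ x : EuclideanSpace ℝ (Fin 3), ∃ r : ℝ, 0 < r ∧
            eLpNorm (uncurry v) ⊤ (volume.restrict (parabolicCylinder r ((T : ℝ), x))) < ⊤ := by
  constructor
  · intro hreg u₀ hu₀ hdiv hdec v hv
    exact lerayHopf_locallyBounded_of_clayR3_solvable hμ hdec (hreg u₀ hu₀ hdiv hdec) hv
  · intro h u₀ hu₀ hdiv hdec
    obtain ⟨v, hv⟩ := exists_isGlobalLerayHopf_of_clayDatum hμ hu₀ hdiv hdec
    obtain ⟨U, P, hU, hP, hns, hE⟩ :=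
      clay_solution_of_locallyBounded_globalLerayHopf hμ hu₀ hdiv hdec hv (h u₀ hu₀ hdiv hdec v hv)
    exact ⟨U, P, hU, hP, hns, hE⟩

/-- **(A) ⇔ the datum-wise local Serrin `L^∞` criterion at every viscosity.**
[cite: FeffermanClay2006, (A) with (4) (6) (7) p. 2] [cite: LemarieRieusset2016, Thm. 15.1 (C) and Prop. 12.3] -/
theorem clayR3_regularity_iff_lerayHopf_locallyBounded :
    clayR3.Regularity ↔
      ∀ μ : ℝ, 0 < μ →
      ∀ (u₀ : EuclideanSpace ℝ (Fin 3) → EuclideanSpace ℝ (Fin 3)), ContDiff ℝ ∞ u₀ →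
        NSWave0.IsDivFree u₀ → HasRapidSpatialDecay u₀ →
        ∀ v : ℝ → EuclideanSpace ℝ (Fin 3) → EuclideanSpace ℝ (Fin 3), IsGlobalLerayHopf μ 0 u₀ v →
          ∀ T : ℝ, 0 < T → ∀ x : EuclideanSpace ℝ (Fin 3), ∃ r : ℝ, 0 < r ∧
            eLpNorm (uncurry v) ⊤ (volume.restrict (parabolicCylinder r ((T : ℝ), x))) < ⊤ :=
  ⟨fun h μ hμ => (clayR3_regularityAt_iff_lerayHopf_locallyBounded hμ).1 (h μ hμ),
    fun h μ hμ => (clayR3_regularityAt_iff_lerayHopf_locallyBounded hμ).2 (h μ hμ)⟩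

/-- **(A) ⇔ the datum-wise local Serrin `L^∞` criterion at ONE viscosity `μ > 0`** (Δ7 scaling,
`clayR3_regularityAt_iff`). [cite: FeffermanClay2006, (A) with (4) (6) (7) p. 2]
[cite: LemarieRieusset2016, Thm. 15.1 (C) and Prop. 12.3] -/
theorem clayR3_regularity_iff_lerayHopf_locallyBounded_at (hμ : 0 < μ) :
    clayR3.Regularity ↔
      ∀ (u₀ : EuclideanSpace ℝ (Fin 3) → EuclideanSpace ℝ (Fin 3)), ContDiff ℝ ∞ u₀ →
        NSWave0.IsDivFree u₀ → HasRapidSpatialDecay u₀ →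
        ∀ v : ℝ → EuclideanSpace ℝ (Fin 3) → EuclideanSpace ℝ (Fin 3), IsGlobalLerayHopf μ 0 u₀ v →
          ∀ T : ℝ, 0 < T → ∀ x : EuclideanSpace ℝ (Fin 3), ∃ r : ℝ, 0 < r ∧
            eLpNorm (uncurry v) ⊤ (volume.restrict (parabolicCylinder r ((T : ℝ), x))) < ⊤ := by
  rw [← clayR3_regularityAt_iff hμ]
  exact clayR3_regularityAt_iff_lerayHopf_locallyBounded hμ

/-! ## (A) ⇔ essential boundedness of Leray–Hopf solutions on every strip -/

/-- **Slice-wise a.e. bounds are product-a.e. bounds** for a field a.e. strongly measurable on the strip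
`(0, T) × Y`: if `‖v(t, y)‖ ≤ M` for a.e. `y`, for every `t ∈ (0, T)`, then `‖v‖ ≤ M` a.e. on the strip
(through a strongly measurable representative and Fubini for a.e. membership). Private helper.
[folklore] -/
private theorem ae_strip_norm_le_of_forall_ae {Y F : Type*} [MeasureSpace Y] [SFinite (volume : Measure Y)]
    [NormedAddCommGroup F] {T M : ℝ} {v : ℝ → Y → F}
    (hvm : AEStronglyMeasurable (uncurry v) (volume.restrict (Ioo 0 T ×ˢ (univ : Set Y))))
    (h : ∀ t ∈ Ioo 0 T, ∀ᵐ y ∂(volume : Measure Y), ‖v t y‖ ≤ M) :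
    ∀ᵐ z ∂(volume.restrict (Ioo 0 T ×ˢ (univ : Set Y))), ‖uncurry v z‖ ≤ M := by
  have hprod : ((volume : Measure (ℝ × Y)).restrict (Ioo 0 T ×ˢ univ)) =
      ((volume : Measure ℝ).restrict (Ioo 0 T)).prod (volume : Measure Y) := by
    rw [Measure.volume_eq_prod, ← Measure.restrict_univ (μ := (volume : Measure Y)),
      Measure.prod_restrict, Measure.restrict_univ]
  rw [hprod] at hvm ⊢
  set g := hvm.mk (uncurry v) with hg_def
  have hg : StronglyMeasurable g := hvm.stronglyMeasurable_mk
  have hvg : uncurry v =ᵐ[((volume : Measure ℝ).restrict (Ioo 0 T)).prod (volume : Measure Y)] g :=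
    hvm.ae_eq_mk
  -- a.e. slices of the representative agree with the slices of `v`
  have hslice : ∀ᵐ t ∂((volume : Measure ℝ).restrict (Ioo 0 T)), ∀ᵐ y ∂(volume : Measure Y),
      uncurry v (t, y) = g (t, y) := Measure.ae_ae_of_ae_prod hvg
  -- the representative is bounded a.e. on the product, by Fubini for a.e. membership
  have hset : MeasurableSet {z : ℝ × Y | ‖g z‖ ≤ M} :=
    measurableSet_le hg.norm.measurable measurable_const
  have hgM : ∀ᵐ z ∂((volume : Measure ℝ).restrict (Ioo 0 T)).prod (volume : Measure Y),
      z ∈ {z : ℝ × Y | ‖g z‖ ≤ M} := by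
    rw [Measure.ae_prod_mem_iff_ae_ae_mem hset]
    filter_upwards [hslice, ae_restrict_mem measurableSet_Ioo] with t ht htI
    filter_upwards [ht, h t htI] with y hy hyM
    rw [← hy]
    exact hyM
  filter_upwards [hgM, hvg] with z hz hzg
  rw [hzg]
  exact hz

/-- **Clay (A) at viscosity `μ` ⇔ every global Leray–Hopf weak solution from a Clay datum is
essentially bounded on every strip `(0, T] × ℝ³`**: `∀ T > 0, ∃ M, ∀ t ∈ (0, T], ‖v(t, x)‖ ≤ M` for
a.e. `x`. (⇒): `lerayHopf_aeBounded_of_clayR3_solvable`; (⇐): the slice-wise a.e. bound is a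
product-a.e. bound on the strip, hence an essential bound on every parabolic cylinder inside it, and
`clayR3_regularityAt_iff_lerayHopf_locallyBounded` concludes.
[cite: FeffermanClay2006, (A) with (4) (6) (7) p. 2] [cite: Leray1934, §34]
[cite: Serrin1962, Thm. (L^∞ case)] [cite: LemarieRieusset2016, Thm. 15.1 (C) and Prop. 12.3]
[cite: Tao2011, Lemma 8.1 and Cor. 11.1] -/
theorem clayR3_regularityAt_iff_lerayHopf_aeBounded (hμ : 0 < μ) :
    clayR3.RegularityAt μ ↔
      ∀ (u₀ : EuclideanSpace ℝ (Fin 3) → EuclideanSpace ℝ (Fin 3)), ContDiff ℝ ∞ u₀ →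
        NSWave0.IsDivFree u₀ → HasRapidSpatialDecay u₀ →
        ∀ v : ℝ → EuclideanSpace ℝ (Fin 3) → EuclideanSpace ℝ (Fin 3), IsGlobalLerayHopf μ 0 u₀ v →
          ∀ T : ℝ, 0 < T → ∃ M : ℝ, ∀ t ∈ Ioc 0 T, ∀ᵐ x ∂volume, ‖v t x‖ ≤ M := by
  constructor
  · intro hreg u₀ hu₀ hdiv hdec v hv T hT
    exact lerayHopf_aeBounded_of_clayR3_solvable hμ hdec (hreg u₀ hu₀ hdiv hdec) hv hT
  · intro h
    refine (clayR3_regularityAt_iff_lerayHopf_locallyBounded hμ).2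
      fun u₀ hu₀ hdiv hdec v hv T hT x => ?_
    obtain ⟨M, hM⟩ := h u₀ hu₀ hdiv hdec v hv T hT
    obtain ⟨hr0, hsub⟩ := parabolicCylinder_subset_strip hT x
    have hstrip : ∀ᵐ z ∂(volume.restrict (Ioo 0 T ×ˢ (univ : Set (EuclideanSpace ℝ (Fin 3))))),
        ‖uncurry v z‖ ≤ M :=
      ae_strip_norm_le_of_forall_ae (hv T hT).weak.1 fun t ht => hM t ⟨ht.1, ht.2.le⟩
    refine ⟨_, hr0, ?_⟩
    rw [eLpNorm_exponent_top]
    exact eLpNormEssSup_lt_top_of_ae_bound (C := M) (ae_restrict_of_ae_restrict_of_subset hsub hstrip)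

/-- **(A) ⇔ essential boundedness of Leray–Hopf solutions on every strip, at every viscosity.**
[cite: FeffermanClay2006, (A) with (4) (6) (7) p. 2] [cite: LemarieRieusset2016, Thm. 15.1 (C) and Prop. 12.3] -/
theorem clayR3_regularity_iff_lerayHopf_aeBounded :
    clayR3.Regularity ↔
      ∀ μ : ℝ, 0 < μ →
      ∀ (u₀ : EuclideanSpace ℝ (Fin 3) → EuclideanSpace ℝ (Fin 3)), ContDiff ℝ ∞ u₀ →
        NSWave0.IsDivFree u₀ → HasRapidSpatialDecay u₀ →
        ∀ v : ℝ → EuclideanSpace ℝ (Fin 3) → EuclideanSpace ℝ (Fin 3), IsGlobalLerayHopf μ 0 u₀ v →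
          ∀ T : ℝ, 0 < T → ∃ M : ℝ, ∀ t ∈ Ioc 0 T, ∀ᵐ x ∂volume, ‖v t x‖ ≤ M :=
  ⟨fun h μ hμ => (clayR3_regularityAt_iff_lerayHopf_aeBounded hμ).1 (h μ hμ),
    fun h μ hμ => (clayR3_regularityAt_iff_lerayHopf_aeBounded hμ).2 (h μ hμ)⟩

/-- **(A) ⇔ essential boundedness of Leray–Hopf solutions on every strip, at ONE viscosity `μ > 0`**
(Δ7 scaling, `clayR3_regularityAt_iff`). [cite: FeffermanClay2006, (A) with (4) (6) (7) p. 2]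
[cite: LemarieRieusset2016, Thm. 15.1 (C) and Prop. 12.3] -/
theorem clayR3_regularity_iff_lerayHopf_aeBounded_at (hμ : 0 < μ) :
    clayR3.Regularity ↔
      ∀ (u₀ : EuclideanSpace ℝ (Fin 3) → EuclideanSpace ℝ (Fin 3)), ContDiff ℝ ∞ u₀ →
        NSWave0.IsDivFree u₀ → HasRapidSpatialDecay u₀ →
        ∀ v : ℝ → EuclideanSpace ℝ (Fin 3) → EuclideanSpace ℝ (Fin 3), IsGlobalLerayHopf μ 0 u₀ v →
          ∀ T : ℝ, 0 < T → ∃ M : ℝ, ∀ t ∈ Ioc 0 T, ∀ᵐ x ∂volume, ‖v t x‖ ≤ M := by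
  rw [← clayR3_regularityAt_iff hμ]
  exact clayR3_regularityAt_iff_lerayHopf_aeBounded hμ

/-! ## (A) ⇔ «every Leray–Hopf solution becomes smooth for `t > 0`» (appended 2026-08-27, lit-4 g7)

Many regularity claims are printed in Leray's 1934 language: «all Leray(–Hopf) solutions become smooth»,
i.e. every global weak solution from the datum agrees, for every `t > 0`, almost everywhere with a
classical solution on `(0, ∞) × ℝ³`. For Clay data this is EQUIVALENT to (A): (⇒) the Clay solution is
classical on `[0, ∞)` and every Leray–Hopf solution from the datum equals it a.e. at every `t > 0`
(weak–strong uniqueness in the Clay class, `IsNavierStokesSolution.ae_eq_of_isLerayHopfOn`); (⇐) a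
classical `U` on `(0, ∞)` is continuous there, hence bounded on the compact `[T/2, T] × B̄(x, 1)`, so the
Leray–Hopf solution is essentially bounded on the parabolic cylinder `Q_r(T, x)`, `r = min 1 √(T/2)`
(slice-wise a.e. equality is product-a.e. by Fubini), and `clayR3_regularityAt_iff_lerayHopf_locallyBounded`
concludes. First consumer: `Literature.Claims.NS.Faliush2026.clayA_of_claimedR3` (C141). -/

/-- Fubini localisation to a product `I × B`: a slice-wise a.e. bound for a product-a.e.-strongly-measurable
`uncurry v` is a product-a.e. bound. [cite: LemarieRieusset2016, Prop. 12.3 (notation)] -/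
private theorem ae_prod_norm_le_of_forall_ae_restrict {Y F : Type*} [MeasureSpace Y]
    [SFinite (volume : Measure Y)] [NormedAddCommGroup F] {I : Set ℝ} {B : Set Y} {M : ℝ}
    {v : ℝ → Y → F} (hI : MeasurableSet I)
    (hvm : AEStronglyMeasurable (uncurry v) (volume.restrict (I ×ˢ B)))
    (h : ∀ t ∈ I, ∀ᵐ y ∂(volume.restrict B), ‖v t y‖ ≤ M) :
    ∀ᵐ z ∂(volume.restrict (I ×ˢ B)), ‖uncurry v z‖ ≤ M := by
  have hprod : ((volume : Measure (ℝ × Y)).restrict (I ×ˢ B)) =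
      ((volume : Measure ℝ).restrict I).prod ((volume : Measure Y).restrict B) := by
    rw [Measure.volume_eq_prod, Measure.prod_restrict]
  rw [hprod] at hvm ⊢
  set g := hvm.mk (uncurry v) with hg_def
  have hg : StronglyMeasurable g := hvm.stronglyMeasurable_mk
  have hvg : uncurry v =ᵐ[((volume : Measure ℝ).restrict I).prod ((volume : Measure Y).restrict B)] g :=
    hvm.ae_eq_mk
  have hslice : ∀ᵐ t ∂((volume : Measure ℝ).restrict I), ∀ᵐ y ∂((volume : Measure Y).restrict B),
      uncurry v (t, y) = g (t, y) := Measure.ae_ae_of_ae_prod hvg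
  have hset : MeasurableSet {z : ℝ × Y | ‖g z‖ ≤ M} :=
    measurableSet_le hg.norm.measurable measurable_const
  have hgM : ∀ᵐ z ∂((volume : Measure ℝ).restrict I).prod ((volume : Measure Y).restrict B),
      z ∈ {z : ℝ × Y | ‖g z‖ ≤ M} := by
    rw [Measure.ae_prod_mem_iff_ae_ae_mem hset]
    filter_upwards [hslice, ae_restrict_mem hI] with t ht htI
    filter_upwards [ht, h t htI] with y hy hyM
    rw [← hy]
    exact hyM
  filter_upwards [hgM, hvg] with z hz hzg
  rw [hzg]
  exact hz

/-- **A Leray–Hopf solution that is a.e. a classical solution on `(0, ∞)` is essentially bounded on a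
parabolic cylinder below every point `(T, x)`, `T > 0`** (continuity of the classical representative on
the compact `[T/2, T] × B̄(x, 1)`; the cylinder `Q_r(T, x)` with `r = min 1 √(T/2)`).
[cite: LemarieRieusset2016, Prop. 12.3 (notation)] -/
theorem lerayHopf_locallyBounded_of_ae_classical (hv : IsGlobalLerayHopf μ 0 u₀ v)
    {U : ℝ → EuclideanSpace ℝ (Fin 3) → EuclideanSpace ℝ (Fin 3)} {P : ℝ → EuclideanSpace ℝ (Fin 3) → ℝ}
    (hU : IsClassicalNSSolutionOn (Ioi 0) μ 0 U P) (hagree : ∀ t : ℝ, 0 < t → U t =ᵐ[volume] v t) :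
    ∀ T : ℝ, 0 < T → ∀ x : EuclideanSpace ℝ (Fin 3), ∃ r : ℝ, 0 < r ∧
      eLpNorm (uncurry v) ⊤ (volume.restrict (parabolicCylinder r ((T : ℝ), x))) < ⊤ := by
  intro T hT x
  set r : ℝ := min 1 (Real.sqrt (T / 2)) with hr_def
  have hr0 : 0 < r := lt_min one_pos (Real.sqrt_pos.2 (by positivity))
  have hr1 : r ≤ 1 := min_le_left _ _
  have hr2 : r ^ 2 ≤ T / 2 := by
    calc r ^ 2 ≤ Real.sqrt (T / 2) ^ 2 := pow_le_pow_left₀ hr0.le (min_le_right _ _) 2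
      _ = T / 2 := Real.sq_sqrt (by positivity)
  -- `U` is bounded on the compact `[T/2, T] × B̄(x, 1)`
  have hK : IsCompact (Icc (T / 2) T ×ˢ Metric.closedBall x 1) :=
    isCompact_Icc.prod (isCompact_closedBall x 1)
  have hKsub : Icc (T / 2) T ×ˢ Metric.closedBall x 1 ⊆
      Ioi (0 : ℝ) ×ˢ (univ : Set (EuclideanSpace ℝ (Fin 3))) :=
    prod_mono (fun t ht => lt_of_lt_of_le (half_pos hT) ht.1) (subset_univ _)
  have hcont : ContinuousOn (uncurry U) (Icc (T / 2) T ×ˢ Metric.closedBall x 1) :=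
    (ContDiffOn.continuousOn hU.smooth_velocity).mono hKsub
  obtain ⟨C, hC⟩ := hK.exists_bound_of_continuousOn hcont
  -- the cylinder lies in the strip `(0, T) × ℝ³`, where `uncurry v` is a.e.-strongly measurable
  have hsub : Ioo (T - r ^ 2) T ×ˢ Metric.ball x r ⊆ Ioo 0 T ×ˢ (univ : Set (EuclideanSpace ℝ (Fin 3))) :=
    prod_mono (fun t ht => ⟨by linarith [ht.1, hr2], ht.2⟩) (subset_univ _)
  have hvm : AEStronglyMeasurable (uncurry v)
      (volume.restrict (Ioo (T - r ^ 2) T ×ˢ Metric.ball x r)) :=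
    (hv T hT).weak.1.mono_measure (Measure.restrict_mono hsub le_rfl)
  have hbd : ∀ t ∈ Ioo (T - r ^ 2) T, ∀ᵐ y ∂(volume.restrict (Metric.ball x r)), ‖v t y‖ ≤ C := by
    intro t ht
    have ht0 : 0 < t := by linarith [ht.1, hr2]
    have htI : t ∈ Icc (T / 2) T := ⟨by linarith [ht.1, hr2], ht.2.le⟩
    refine (ae_restrict_iff' measurableSet_ball).2 ?_
    filter_upwards [hagree t ht0] with y hy hyB
    rw [← hy]
    have hy1 : y ∈ Metric.closedBall x 1 :=
      Metric.mem_closedBall.2 ((le_of_lt (Metric.mem_ball.1 hyB)).trans hr1)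
    exact hC (t, y) ⟨htI, hy1⟩
  have hae := ae_prod_norm_le_of_forall_ae_restrict measurableSet_Ioo hvm hbd
  refine ⟨r, hr0, ?_⟩
  rw [eLpNorm_exponent_top]
  exact eLpNormEssSup_lt_top_of_ae_bound (C := C) hae

/-- **Clay (A) at viscosity `μ` ⇔ every global Leray–Hopf weak solution from a Clay datum agrees, for
every `t > 0`, a.e. with a classical solution on `(0, ∞)`** («all Leray solutions become smooth», Leray
1934 §34 language). (⇒): the Clay solution is classical on `[0, ∞)` and equals every Leray–Hopf solution
a.e. at every `t > 0` (`IsNavierStokesSolution.ae_eq_of_isLerayHopfOn`); (⇐):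
`lerayHopf_locallyBounded_of_ae_classical` + `clayR3_regularityAt_iff_lerayHopf_locallyBounded`.
[cite: FeffermanClay2006, (A) with (4) (6) (7) p. 2] [cite: Leray1934, §34]
[cite: LemarieRieusset2016, Thm. 15.1 (C) and Prop. 12.3] [cite: Tao2011, Lemma 8.1 and Cor. 11.1] -/
theorem clayR3_regularityAt_iff_lerayHopf_aeClassical (hμ : 0 < μ) :
    clayR3.RegularityAt μ ↔
      ∀ (u₀ : EuclideanSpace ℝ (Fin 3) → EuclideanSpace ℝ (Fin 3)), ContDiff ℝ ∞ u₀ →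
        NSWave0.IsDivFree u₀ → HasRapidSpatialDecay u₀ →
        ∀ v : ℝ → EuclideanSpace ℝ (Fin 3) → EuclideanSpace ℝ (Fin 3), IsGlobalLerayHopf μ 0 u₀ v →
          ∃ (U : ℝ → EuclideanSpace ℝ (Fin 3) → EuclideanSpace ℝ (Fin 3))
            (P : ℝ → EuclideanSpace ℝ (Fin 3) → ℝ),
            IsClassicalNSSolutionOn (Ioi 0) μ 0 U P ∧ ∀ t : ℝ, 0 < t → U t =ᵐ[volume] v t := by
  constructor
  · intro hreg u₀ hu₀ hdiv hdec v hv
    obtain ⟨U, P, hU, hP, hns, hE⟩ := hreg u₀ hu₀ hdiv hdec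
    have hcl : IsClassicalNSSolutionOn (Ici 0) μ 0 U P :=
      (isNavierStokesSolution_and_smooth_iff.1 ⟨hns, hU, hP⟩).1
    refine ⟨U, P, hcl.mono Ioi_subset_Ici_self (uniqueDiffOn_Ioi 0), fun t ht => ?_⟩
    exact (hns.ae_eq_of_isLerayHopfOn hμ ht hdec hU hP hE (hv t ht) t ⟨ht, le_rfl⟩).symm
  · intro h
    refine (clayR3_regularityAt_iff_lerayHopf_locallyBounded hμ).2
      fun u₀ hu₀ hdiv hdec v hv => ?_
    obtain ⟨U, P, hU, hagree⟩ := h u₀ hu₀ hdiv hdec v hv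
    exact lerayHopf_locallyBounded_of_ae_classical hv hU hagree

/-- **(A) ⇔ «every Leray–Hopf solution from a Clay datum is a.e. classical on (0, ∞)», at every
viscosity.** [cite: FeffermanClay2006, (A) with (4) (6) (7) p. 2] [cite: Leray1934, §34] -/
theorem clayR3_regularity_iff_lerayHopf_aeClassical :
    clayR3.Regularity ↔
      ∀ μ : ℝ, 0 < μ →
      ∀ (u₀ : EuclideanSpace ℝ (Fin 3) → EuclideanSpace ℝ (Fin 3)), ContDiff ℝ ∞ u₀ →
        NSWave0.IsDivFree u₀ → HasRapidSpatialDecay u₀ →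
        ∀ v : ℝ → EuclideanSpace ℝ (Fin 3) → EuclideanSpace ℝ (Fin 3), IsGlobalLerayHopf μ 0 u₀ v →
          ∃ (U : ℝ → EuclideanSpace ℝ (Fin 3) → EuclideanSpace ℝ (Fin 3))
            (P : ℝ → EuclideanSpace ℝ (Fin 3) → ℝ),
            IsClassicalNSSolutionOn (Ioi 0) μ 0 U P ∧ ∀ t : ℝ, 0 < t → U t =ᵐ[volume] v t :=
  ⟨fun h μ hμ => (clayR3_regularityAt_iff_lerayHopf_aeClassical hμ).1 (h μ hμ),
    fun h μ hμ => (clayR3_regularityAt_iff_lerayHopf_aeClassical hμ).2 (h μ hμ)⟩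

/-- **(A) ⇔ the same at ONE viscosity `μ > 0`** (Δ7 scaling, `clayR3_regularityAt_iff`).
[cite: FeffermanClay2006, (A) with (4) (6) (7) p. 2] [cite: Leray1934, §34] -/
theorem clayR3_regularity_iff_lerayHopf_aeClassical_at (hμ : 0 < μ) :
    clayR3.Regularity ↔
      ∀ (u₀ : EuclideanSpace ℝ (Fin 3) → EuclideanSpace ℝ (Fin 3)), ContDiff ℝ ∞ u₀ →
        NSWave0.IsDivFree u₀ → HasRapidSpatialDecay u₀ →
        ∀ v : ℝ → EuclideanSpace ℝ (Fin 3) → EuclideanSpace ℝ (Fin 3), IsGlobalLerayHopf μ 0 u₀ v →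
          ∃ (U : ℝ → EuclideanSpace ℝ (Fin 3) → EuclideanSpace ℝ (Fin 3))
            (P : ℝ → EuclideanSpace ℝ (Fin 3) → ℝ),
            IsClassicalNSSolutionOn (Ioi 0) μ 0 U P ∧ ∀ t : ℝ, 0 < t → U t =ᵐ[volume] v t := by
  rw [← clayR3_regularityAt_iff hμ]
  exact clayR3_regularityAt_iff_lerayHopf_aeClassical hμ

/-! ## Per-SOLUTION doors (keeper rev 2, ns-claims-lit-4 g9): ONE Leray–Hopf solution that is classical
for `t > 0` already gives (A)

The doors above quantify over EVERY global Leray–Hopf solution from the datum. Manuscripts of the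
«construct a Leray–Hopf (Leray / Galerkin) limit and show IT is smooth» type deliver ONE such solution per
datum — and one is enough: weak–strong uniqueness is applied to THAT solution against the maximal Kato
solution from the Clay datum, and the Kato maximal-time dichotomy does the rest (both inside
`clay_solution_of_locallyBounded_globalLerayHopf`). `ℝ³` twin of the per-solution (B) doors of
`ClayPeriodicLerayHopfBridge.lean` (rev 2). [cite: FeffermanClay2006, (A) with (4) (6) (7) p. 2]
[cite: LemarieRieusset2016, Thm. 15.1 (C) and Prop. 12.3] [cite: Serrin1962, Thm. (L^∞ case)] -/

/-- **Per-solution door, local `L^∞` form**: a Clay datum carrying ONE global Leray–Hopf solution that is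
essentially bounded on a parabolic cylinder below every `(T, x)`, `T > 0`, has a Clay (A) solution.
(Repackaging of `clay_solution_of_locallyBounded_globalLerayHopf` as `clayR3.Solvable`.)
[cite: FeffermanClay2006, (A) p. 2] [cite: LemarieRieusset2016, Thm. 15.1 (C)] -/
theorem clayR3_solvable_of_isGlobalLerayHopf_locallyBounded (hμ : 0 < μ) (hu₀ : ContDiff ℝ ∞ u₀)
    (hdiv : NSWave0.IsDivFree u₀) (hdec : HasRapidSpatialDecay u₀) (hv : IsGlobalLerayHopf μ 0 u₀ v)
    (hbd : ∀ T : ℝ, 0 < T → ∀ x : EuclideanSpace ℝ (Fin 3), ∃ r : ℝ, 0 < r ∧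
      eLpNorm (uncurry v) ⊤ (volume.restrict (parabolicCylinder r ((T : ℝ), x))) < ⊤) :
    clayR3.Solvable μ 0 u₀ := by
  obtain ⟨U, P, hU, hP, hns, hE⟩ := clay_solution_of_locallyBounded_globalLerayHopf hμ hu₀ hdiv hdec hv hbd
  exact ⟨U, P, hU, hP, hns, hE⟩

/-- **Per-solution door, a.e.-classical form**: a Clay datum carrying ONE global Leray–Hopf solution `v`
that agrees for every `t > 0` a.e. with a classical solution `(U, P)` on `(0, ∞) × ℝ³` has a Clay (A)
solution. [cite: FeffermanClay2006, (A) p. 2] [cite: LemarieRieusset2016, Thm. 15.1 (C) and Prop. 12.3] -/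
theorem clayR3_solvable_of_isGlobalLerayHopf_aeClassical (hμ : 0 < μ) (hu₀ : ContDiff ℝ ∞ u₀)
    (hdiv : NSWave0.IsDivFree u₀) (hdec : HasRapidSpatialDecay u₀) (hv : IsGlobalLerayHopf μ 0 u₀ v)
    {U : ℝ → EuclideanSpace ℝ (Fin 3) → EuclideanSpace ℝ (Fin 3)} {P : ℝ → EuclideanSpace ℝ (Fin 3) → ℝ}
    (hU : IsClassicalNSSolutionOn (Ioi 0) μ 0 U P) (hagree : ∀ t : ℝ, 0 < t → U t =ᵐ[volume] v t) :
    clayR3.Solvable μ 0 u₀ :=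
  clayR3_solvable_of_isGlobalLerayHopf_locallyBounded hμ hu₀ hdiv hdec hv
    (lerayHopf_locallyBounded_of_ae_classical hv hU hagree)

/-- **Per-solution door, classical form**: ONE global Leray–Hopf solution from the Clay datum that is itself
a classical solution on `(0, ∞) × ℝ³` (with some pressure) gives a Clay (A) solution for that datum.
[cite: FeffermanClay2006, (A) p. 2] [cite: LemarieRieusset2016, Thm. 15.1 (C)] -/
theorem clayR3_solvable_of_isGlobalLerayHopf_classical (hμ : 0 < μ) (hu₀ : ContDiff ℝ ∞ u₀)
    (hdiv : NSWave0.IsDivFree u₀) (hdec : HasRapidSpatialDecay u₀) (hv : IsGlobalLerayHopf μ 0 u₀ v)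
    {q : ℝ → EuclideanSpace ℝ (Fin 3) → ℝ} (hcl : IsClassicalNSSolutionOn (Ioi 0) μ 0 v q) :
    clayR3.Solvable μ 0 u₀ :=
  clayR3_solvable_of_isGlobalLerayHopf_aeClassical hμ hu₀ hdiv hdec hv hcl fun _ _ => EventuallyEq.rfl

/-- **(A) at viscosity `μ` from ONE a.e.-classical Leray–Hopf solution per Clay datum.**
[cite: FeffermanClay2006, (A) with (4) (6) (7) p. 2] [cite: LemarieRieusset2016, Thm. 15.1 (C) and Prop. 12.3] -/
theorem clayR3_regularityAt_of_lerayHopf_aeClassical (hμ : 0 < μ)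
    (h : ∀ (u₀ : EuclideanSpace ℝ (Fin 3) → EuclideanSpace ℝ (Fin 3)), ContDiff ℝ ∞ u₀ →
      NSWave0.IsDivFree u₀ → HasRapidSpatialDecay u₀ →
      ∃ (v U : ℝ → EuclideanSpace ℝ (Fin 3) → EuclideanSpace ℝ (Fin 3))
        (P : ℝ → EuclideanSpace ℝ (Fin 3) → ℝ),
        IsGlobalLerayHopf μ 0 u₀ v ∧ IsClassicalNSSolutionOn (Ioi 0) μ 0 U P ∧
          ∀ t : ℝ, 0 < t → U t =ᵐ[volume] v t) :
    clayR3.RegularityAt μ := by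
  intro u₀ hu₀ hdiv hdec
  obtain ⟨v, U, P, hv, hU, hagree⟩ := h u₀ hu₀ hdiv hdec
  exact clayR3_solvable_of_isGlobalLerayHopf_aeClassical hμ hu₀ hdiv hdec hv hU hagree

/-- **(A) at viscosity `μ` from ONE classical-for-`t > 0` Leray–Hopf solution per Clay datum** («the Leray
solution we construct is smooth for positive times»). [cite: FeffermanClay2006, (A) p. 2]
[cite: LemarieRieusset2016, Thm. 15.1 (C)] -/
theorem clayR3_regularityAt_of_lerayHopf_classical (hμ : 0 < μ)
    (h : ∀ (u₀ : EuclideanSpace ℝ (Fin 3) → EuclideanSpace ℝ (Fin 3)), ContDiff ℝ ∞ u₀ →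
      NSWave0.IsDivFree u₀ → HasRapidSpatialDecay u₀ →
      ∃ (v : ℝ → EuclideanSpace ℝ (Fin 3) → EuclideanSpace ℝ (Fin 3)) (q : ℝ → EuclideanSpace ℝ (Fin 3) → ℝ),
        IsGlobalLerayHopf μ 0 u₀ v ∧ IsClassicalNSSolutionOn (Ioi 0) μ 0 v q) :
    clayR3.RegularityAt μ := by
  intro u₀ hu₀ hdiv hdec
  obtain ⟨v, q, hv, hcl⟩ := h u₀ hu₀ hdiv hdec
  exact clayR3_solvable_of_isGlobalLerayHopf_classical hμ hu₀ hdiv hdec hv hcl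

/-- **(A) at every viscosity from the per-solution hypothesis at one `μ > 0`** (scaling,
`clayR3_regularityAt_iff`). [cite: FeffermanClay2006, (A) p. 2] [cite: Tao2013Localisation, Rem. 1.2 footnote] -/
theorem clayR3_regularity_of_lerayHopf_aeClassical (hμ : 0 < μ)
    (h : ∀ (u₀ : EuclideanSpace ℝ (Fin 3) → EuclideanSpace ℝ (Fin 3)), ContDiff ℝ ∞ u₀ →
      NSWave0.IsDivFree u₀ → HasRapidSpatialDecay u₀ →
      ∃ (v U : ℝ → EuclideanSpace ℝ (Fin 3) → EuclideanSpace ℝ (Fin 3))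
        (P : ℝ → EuclideanSpace ℝ (Fin 3) → ℝ),
        IsGlobalLerayHopf μ 0 u₀ v ∧ IsClassicalNSSolutionOn (Ioi 0) μ 0 U P ∧
          ∀ t : ℝ, 0 < t → U t =ᵐ[volume] v t) :
    clayR3.Regularity :=
  (clayR3_regularityAt_iff hμ).1 (clayR3_regularityAt_of_lerayHopf_aeClassical hμ h)


end

end Literature.Claims.NS.ClayVariants

-- WHAT THIS IS NOT: not a claim about NS regularity or blow-up; not a claim about any author beyond
-- the typed locator.
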